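import Mathlib
import HarnessLib

/-!
# Kernel-checkable degree-2 Positivstellensatz certificates for the cut-pattern laws of `m` relays (lane prim-rate, constants-miner 1, gen 34; CANDIDATES §GEN-33 R324, NEXT-g34 item 1)

Support file for the closed crux `NoHeavyLowerTail` (stmt-CriticalPhenomena-4575), majority-gluing line.  Generic layer, no percolation.

THE LANGUAGE.  Fix `m` relays of a hub.  The variables are `x_K`, `K < 2^m` (read: the probability that EXACTLY the relays in the bitmask
`K` are cut from the hub) and `x_D`, `D = 2^m` (read: a bound `δ` on the marginals).  Linear forms: `T = Σ_{|K| ≥ h} x_K`, the marginals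
`m_x = Σ_{K ∋ x} x_K`, the cylinders `f(A,X) = Σ_{K ⊇ X, K ∩ A = ∅} x_K` («`A` attached, `X` cut»), and a CASE family `E_x`
(`fam = 0`: the atoms `x_{[m]∖x}`; `fam = 1`: `Σ_{|K| ≥ h, x ∉ K} x_K`; else the marginals).  A certificate (`Cert`) for the constant
`cN/cD` is a list of natural-number multipliers for
* `(cN·x_D − cD·T)·x_b` (the multiplier `ℓ = Σ n·x_b` of the conclusion; `lin` entries of kind `0`),
* `(x_D − m_x)·x_b` (kind `1`), `(E_{x+1} − E_x)·x_b` (kind `2`),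
* `f(A∪B, X∩Y)·f(∅, X∪Y) − f(A,X)·f(B,Y)` (`rows`: the hub-rooted van den Berg–Kahn inequalities [cite: VandenbergKahn2001, Thm 1.2 (p. 123)],
  carried as four membership masks checked against `(A,X,B,Y)` by `checkW`),
* squares `(a·f₁ − b·f₂)²` of differences of mask forms (`sqs`),
and the checks verify — in exact integer arithmetic, by `decide +kernel` on explicit data — that
`(cN·x_D − cD·T)·ℓ − Σ n·(x_D − m_x)·x_b − Σ n·(E_{x+1} − E_x)·x_b − Σ n·(row) − Σ n·(square)` has NONNEGATIVE coefficients on every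
monomial `x_i x_j`.  This file: the data structures, the SPECIFICATION `Cert.S i j` of the symmetrised coefficient of `x_i x_j`, the
structural check `Cert.checkW` (denominator, `ℓ_D > 0`, masks = cylinders), and the generic real semantics `linv` / `quadv` with their
algebra.  The kernel evaluation of the coefficients is `…MajorityGluingQCertVec` (`Cert.checkQ`), SOUNDNESS is `…MajorityGluingQCertSound`
(`Cert.sound`: a passing certificate gives `cD·T ≤ cN·x_D` at every nonnegative point satisfying the marginal, case and row hypotheses),
the percolation dictionary (patterns = cut sets of the relays, rows = van den Berg–Kahn, case chain by relabelling) is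
`…MajorityGluingEightCert`, and the data of the `(6,4)` certificate with `cN/cD = 63/50` are `…MajorityGluingQCertSixFour*`.
Pure list / integer arithmetic; no sorries.
-/

namespace Summit.CriticalPhenomena.PercolationContinuityZ3.Theorems

namespace HubOnly
namespace QCert

/-! ### Certificates as data -/

/-- A linear-times-variable entry `n·G·x_b` (the variable `b` is the key of its group): `kind = 0`: `G = cN·x_D − cD·T`;
`kind = 1`: `G = −(x_D − m_x)`; `kind = 2`: `G = −(E_{x+1} − E_x)`. -/
structure LinE where
  /-- `0` = multiplier of the conclusion, `1` = marginal slack of relay `x`, `2` = case difference `E_{x+1} − E_x` -/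
  kind : ℕ
  /-- the relay / case index -/
  x : ℕ
  /-- the multiplier -/
  n : ℕ

/-- A van den Berg–Kahn row `n·(f(A∪B,X∩Y)·f(∅,X∪Y) − f(A,X)·f(B,Y))` with the membership masks of its four cylinders
(`m1 ↔ f(A,X)`, `m2 ↔ f(B,Y)`, `m3 ↔ f(A∪B,X∩Y)`, `m4 ↔ f(∅,X∪Y)`; bit `K` of a mask = «pattern `K` belongs to the cylinder»). -/
structure RowE where
  /-- attached set of the first factor -/
  A : ℕ
  /-- cut set of the first factor -/
  X : ℕ
  /-- attached set of the second factor -/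
  B : ℕ
  /-- cut set of the second factor -/
  Y : ℕ
  /-- the multiplier -/
  n : ℕ
  /-- mask of `f(A,X)` -/
  m1 : ℕ
  /-- mask of `f(B,Y)` -/
  m2 : ℕ
  /-- mask of `f(A∪B,X∩Y)` -/
  m3 : ℕ
  /-- mask of `f(∅,X∪Y)` -/
  m4 : ℕ

/-- A square entry `n·(a·f₁ − b·f₂)²`, `f_i` the mask forms of `m1`, `m2`. -/
structure SqE where
  /-- coefficient of the first form -/
  a : ℕ
  /-- coefficient of the second form -/
  b : ℕ
  /-- the multiplier -/
  n : ℕ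
  /-- mask of the first form -/
  m1 : ℕ
  /-- mask of the second form -/
  m2 : ℕ

/-- A certificate for the cell `(m, h)` and the constant `cN/cD`: case family, grouped linear entries (key = the variable `b`),
rows and squares in chunks (chunking only bounds the kernel's recursion depth). -/
structure Cert where
  /-- number of relays -/
  m : ℕ
  /-- threshold: `T = Σ_{|K| ≥ h} x_K` -/
  h : ℕ
  /-- numerator of the constant -/
  cN : ℕ
  /-- denominator of the constant -/
  cD : ℕ
  /-- case family (`0`: atoms `x_{[m]∖x}`, `1`: `Σ_{|K|≥h, x∉K} x_K`, else marginals) -/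
  fam : ℕ
  /-- linear entries grouped by their variable `b` -/
  lin : List (ℕ × List LinE)
  /-- van den Berg–Kahn rows, chunked -/
  rows : List (List RowE)
  /-- squares, chunked -/
  sqs : List (List SqE)

/-! ### Membership tests (patterns are bitmasks `K < 2^m`; the variable `2^m` is `x_D`) -/

/-- Bit `i` of `m` (`= Nat.testBit m i`, `tb_eq`), written with three raw `Nat` operations for fast kernel evaluation. -/
def tb (m i : ℕ) : Bool := Nat.beq (Nat.land (Nat.shiftRight m i) 1) 1

/-- `tb` is `Nat.testBit`. -/
theorem tb_eq (m i : ℕ) : tb m i = m.testBit i := by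
  rw [Nat.testBit_eq_decide_div_mod_eq]
  unfold tb
  rw [show Nat.land (Nat.shiftRight m i) 1 = (m >>> i) &&& 1 from rfl, Nat.shiftRight_eq_div_pow, Nat.and_one_is_mod]
  rcases Nat.mod_two_eq_zero_or_one (m / 2 ^ i) with h | h <;> rw [h] <;> rfl

/-- Number of set bits of `K` among the low `m` bits. -/
def popc (m K : ℕ) : ℕ := ((List.range m).filter fun x => tb K x).length

/-- «pattern `K` has `X` cut and `A` attached»: `K < 2^m`, `K ⊇ X`, `K ∩ A = ∅` (raw `Nat` operations for fast kernel evaluation;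
`cylMem_iff` in `…MajorityGluingEightCert` is the set-theoretic reading). -/
def cylMem (m A X K : ℕ) : Bool := Nat.blt K (2 ^ m) && Nat.beq (Nat.land K X) X && Nat.beq (Nat.land K A) 0

namespace Cert

variable (c : Cert)

/-- The index of the variable `x_D` (`δ`). -/
def D : ℕ := 2 ^ c.m

/-- The number of variables. -/
def NV : ℕ := 2 ^ c.m + 1

/-- «pattern `K` has at least `h` relays cut». -/
def tMem (K : ℕ) : Bool := decide (K < 2 ^ c.m) && decide (c.h ≤ popc c.m K)

/-- «pattern `K` has relay `x` cut». -/
def margMem (x K : ℕ) : Bool := decide (K < 2 ^ c.m) && tb K x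

/-- «pattern `K` belongs to the case event `E_x`». -/
def eMem (x K : ℕ) : Bool :=
  if c.fam = 0 then decide (K < 2 ^ c.m) && (K == 2 ^ c.m - 1 - 2 ^ x)
  else if c.fam = 1 then decide (K < 2 ^ c.m) && decide (c.h ≤ popc c.m K) && !tb K x
  else c.margMem x K

/-! ### The coefficient array and the checks -/

/-- `1`/`0` of a Boolean, as an integer. -/
def bi (b : Bool) : ℤ := if b then 1 else 0

/-- The linear form `G` of a linear entry, as a coefficient function. -/
def G (e : LinE) (i : ℕ) : ℤ :=
  if e.kind = 0 then (if i = c.D then (c.cN : ℤ) else 0) - (if c.tMem i then (c.cD : ℤ) else 0)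
  else if e.kind = 1 then bi (c.margMem e.x i) - (if i = c.D then 1 else 0)
  else bi (c.eMem e.x i) - bi (c.eMem (e.x + 1) i)

/-- Contribution of the linear entries to the ordered-pair coefficient `(i, j)`. -/
def linC (i j : ℕ) : ℤ :=
  (c.lin.map fun g => if g.1 = j then (g.2.map fun e => (e.n : ℤ) * c.G e i).sum else 0).sum

/-- Contribution of a row to the ordered-pair coefficient `(i, j)`: `n·([f₁ ∋ i][f₂ ∋ j] − [f₃ ∋ i][f₄ ∋ j])`. -/
def _root_.Summit.CriticalPhenomena.PercolationContinuityZ3.Theorems.HubOnly.QCert.RowE.coef (r : RowE) (i j : ℕ) : ℤ :=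
  match tb r.m1 i && tb r.m2 j, tb r.m3 i && tb r.m4 j with
  | true, false => r.n
  | false, true => -(r.n : ℤ)
  | _, _ => 0

/-- Contribution of the rows to the ordered-pair coefficient `(i, j)`. -/
def rowC (i j : ℕ) : ℤ := (c.rows.map fun ch => (ch.map fun r => r.coef i j).sum).sum

/-- The linear form `a·f₁ − b·f₂` of a square entry, as a coefficient function. -/
def _root_.Summit.CriticalPhenomena.PercolationContinuityZ3.Theorems.HubOnly.QCert.SqE.u (s : SqE) (i : ℕ) : ℤ :=
  (if tb s.m1 i then (s.a : ℤ) else 0) - (if tb s.m2 i then (s.b : ℤ) else 0)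

/-- Contribution of a square entry to the ordered-pair coefficient `(i, j)`: `−n·u(i)·u(j)`. -/
def _root_.Summit.CriticalPhenomena.PercolationContinuityZ3.Theorems.HubOnly.QCert.SqE.coef (s : SqE) (i j : ℕ) : ℤ :=
  if s.u i = 0 then 0 else -((s.n : ℤ) * s.u i * s.u j)

/-- Contribution of the squares to the ordered-pair coefficient `(i, j)`. -/
def sqC (i j : ℕ) : ℤ := (c.sqs.map fun ch => (ch.map fun s => s.coef i j).sum).sum

/-- The ordered-pair coefficient array of `LHS − RHS`. -/
def C (i j : ℕ) : ℤ := c.linC i j + c.rowC i j + c.sqC i j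

/-- The symmetrised coefficient `C(i,j) + C(j,i)` (= the coefficient of the monomial `x_i x_j` for `i ≠ j`, twice it for `i = j`). -/
def S (i j : ℕ) : ℤ := c.C i j + c.C j i

/-- A mask agrees with the cylinder `f(A,X)` on all patterns and has no higher bits. -/
def maskOK (A X mk : ℕ) : Bool :=
  Nat.blt mk (2 ^ 2 ^ c.m) && (List.range (2 ^ c.m)).all fun K => cond (tb mk K) (cylMem c.m A X K) (!cylMem c.m A X K)

/-- Well-formedness of a row: sets below `2^m`, masks = the four cylinders of the van den Berg–Kahn inequality. -/
def rowOK (r : RowE) : Bool :=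
  decide (r.A < 2 ^ c.m) && decide (r.X < 2 ^ c.m) && decide (r.B < 2 ^ c.m) && decide (r.Y < 2 ^ c.m) &&
    c.maskOK r.A r.X r.m1 && c.maskOK r.B r.Y r.m2 && c.maskOK (r.A ||| r.B) (r.X &&& r.Y) r.m3 && c.maskOK 0 (r.X ||| r.Y) r.m4

/-- Well-formedness of a linear group: variable in range, relay / case indices in range. -/
def linOK (g : ℕ × List LinE) : Bool :=
  decide (g.1 < c.NV) && g.2.all fun e => decide (e.kind ≤ 2) && (!(e.kind == 1) || decide (e.x < c.m)) &&
    (!(e.kind == 2) || decide (e.x + 1 < c.m))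

/-- The `x_D`-coefficient of the multiplier `ℓ` of the conclusion. -/
def ellD : ℕ := (c.lin.map fun g => if g.1 = c.D then (g.2.map fun e => if e.kind = 0 then e.n else 0).sum else 0).sum

/-- **The structural check**: positive denominator, `h ≥ 1`, `ℓ_D > 0`, well-formed groups and rows. -/
def checkW : Bool :=
  decide (0 < c.cD) && decide (1 ≤ c.h) && decide (0 < c.ellD) && c.lin.all c.linOK && c.rows.all fun ch => ch.all c.rowOK

/-! ### Semantics: linear and quadratic forms at a real point -/

end Cert

noncomputable section

/-- The value of a linear form (coefficient function `L`) at the point `v`, over the variables `< N`. -/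
def linv (N : ℕ) (L : ℕ → ℤ) (v : ℕ → ℝ) : ℝ := ∑ i ∈ Finset.range N, (L i : ℝ) * v i

/-- The value of an ordered-pair coefficient array at the point `v`. -/
def quadv (N : ℕ) (Q : ℕ → ℕ → ℤ) (v : ℕ → ℝ) : ℝ :=
  ∑ i ∈ Finset.range N, ∑ j ∈ Finset.range N, (Q i j : ℝ) * (v i * v j)

/-- `linv` is additive in the form. -/
theorem linv_add (N : ℕ) (L₁ L₂ : ℕ → ℤ) (v : ℕ → ℝ) :
    linv N (fun i => L₁ i + L₂ i) v = linv N L₁ v + linv N L₂ v := by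
  unfold linv; rw [← Finset.sum_add_distrib]; refine Finset.sum_congr rfl fun i _ => ?_; push_cast; ring

/-- `linv` of a difference. -/
theorem linv_sub (N : ℕ) (L₁ L₂ : ℕ → ℤ) (v : ℕ → ℝ) :
    linv N (fun i => L₁ i - L₂ i) v = linv N L₁ v - linv N L₂ v := by
  unfold linv; rw [← Finset.sum_sub_distrib]; refine Finset.sum_congr rfl fun i _ => ?_; push_cast; ring

/-- `linv` of a scalar multiple. -/
theorem linv_smul (N : ℕ) (k : ℤ) (L : ℕ → ℤ) (v : ℕ → ℝ) :
    linv N (fun i => k * L i) v = k * linv N L v := by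
  unfold linv; rw [Finset.mul_sum]; refine Finset.sum_congr rfl fun i _ => ?_; push_cast; ring

/-- `linv` of a list sum of forms. -/
theorem linv_listSum {α : Type*} (N : ℕ) (l : List α) (f : α → ℕ → ℤ) (v : ℕ → ℝ) :
    linv N (fun i => (l.map fun a => f a i).sum) v = (l.map fun a => linv N (f a) v).sum := by
  induction l with
  | nil => simp [linv]
  | cons a l ih =>
    simp only [List.map_cons, List.sum_cons]
    rw [← ih, ← linv_add]

/-- The form `[i = b]` evaluates to `v b` (for `b < N`). -/
theorem linv_single (N b : ℕ) (hb : b < N) (v : ℕ → ℝ) :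
    linv N (fun i => if i = b then 1 else 0) v = v b := by
  unfold linv
  rw [Finset.sum_eq_single b]
  · simp
  · intro i _ hib; simp [hib]
  · intro hb'; exact absurd (Finset.mem_range.2 hb) hb'

/-- A single term of a `0/1`-form is below its value at a nonnegative point. -/
theorem le_linv_of_mem (N : ℕ) (P : ℕ → Bool) (v : ℕ → ℝ) (hv : ∀ i, 0 ≤ v i) (K : ℕ) (hK : K < N) (hP : P K = true) :
    v K ≤ linv N (fun i => Cert.bi (P i)) v := by
  unfold linv
  have h := Finset.single_le_sum (f := fun i => (Cert.bi (P i) : ℝ) * v i) (s := Finset.range N)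
    (fun i _ => mul_nonneg (by dsimp only [Cert.bi]; split <;> simp) (hv i)) (Finset.mem_range.2 hK)
  simp only [hP, Cert.bi, if_true, Int.cast_one, one_mul] at h
  exact h

/-- A `0/1`-form is nonnegative at a nonnegative point. -/
theorem linv_bi_nonneg (N : ℕ) (P : ℕ → Bool) (v : ℕ → ℝ) (hv : ∀ i, 0 ≤ v i) :
    0 ≤ linv N (fun i => Cert.bi (P i)) v :=
  Finset.sum_nonneg fun i _ => mul_nonneg (by dsimp only [Cert.bi]; split <;> simp) (hv i)

/-- `quadv` is additive in the array. -/
theorem quadv_add (N : ℕ) (Q₁ Q₂ : ℕ → ℕ → ℤ) (v : ℕ → ℝ) :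
    quadv N (fun i j => Q₁ i j + Q₂ i j) v = quadv N Q₁ v + quadv N Q₂ v := by
  unfold quadv; rw [← Finset.sum_add_distrib]; refine Finset.sum_congr rfl fun i _ => ?_
  rw [← Finset.sum_add_distrib]; refine Finset.sum_congr rfl fun j _ => ?_; push_cast; ring

/-- `quadv` of a list sum is the sum of the `quadv`s. -/
theorem quadv_listSum {α : Type*} (N : ℕ) (l : List α) (f : α → ℕ → ℕ → ℤ) (v : ℕ → ℝ) :
    quadv N (fun i j => (l.map fun a => f a i j).sum) v = (l.map fun a => quadv N (f a) v).sum := by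
  induction l with
  | nil => simp [quadv]
  | cons a l ih =>
    simp only [List.map_cons, List.sum_cons]
    rw [← ih, ← quadv_add]

/-- **Product of two linear forms** as a `quadv`. -/
theorem quadv_mul (N : ℕ) (L₁ L₂ : ℕ → ℤ) (v : ℕ → ℝ) :
    quadv N (fun i j => L₁ i * L₂ j) v = linv N L₁ v * linv N L₂ v := by
  unfold quadv linv
  rw [Finset.sum_mul_sum]
  refine Finset.sum_congr rfl fun i _ => Finset.sum_congr rfl fun j _ => ?_
  push_cast; ring

/-- A form times a single variable: `quadv` of `[b = j]·F(i)` is `F(v)·v_b` (and `0` if `b ≥ N`). -/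
theorem quadv_col (N b : ℕ) (F : ℕ → ℤ) (v : ℕ → ℝ) :
    quadv N (fun i j => if b = j then F i else 0) v = if b < N then linv N F v * v b else 0 := by
  have e : (fun i j => if b = j then F i else 0) = fun i j => F i * (if j = b then 1 else 0) := by
    funext i j
    by_cases hbj : b = j
    · subst hbj; simp
    · rw [if_neg hbj, if_neg (Ne.symm hbj), mul_zero]
  rw [e, quadv_mul]
  split_ifs with hb
  · rw [linv_single N b hb]
  · have : linv N (fun i => if i = b then (1 : ℤ) else 0) v = 0 := by
      unfold linv
      refine Finset.sum_eq_zero fun i hi => ?_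
      have : i ≠ b := fun h => hb (h ▸ Finset.mem_range.1 hi)
      simp [this]
    rw [this, mul_zero]

/-- **Symmetrisation:** if `Q(i,j) + Q(j,i) ≥ 0` on `[0,N)²` then `quadv N Q v ≥ 0` at every nonnegative point. -/
theorem quadv_nonneg_of_symm (N : ℕ) (Q : ℕ → ℕ → ℤ) (v : ℕ → ℝ) (hv : ∀ i, 0 ≤ v i)
    (hS : ∀ i < N, ∀ j < N, 0 ≤ Q i j + Q j i) : 0 ≤ quadv N Q v := by
  have hcomm : quadv N Q v = ∑ i ∈ Finset.range N, ∑ j ∈ Finset.range N, (Q j i : ℝ) * (v j * v i) := by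
    unfold quadv; rw [Finset.sum_comm]
  have h2 : quadv N Q v + ∑ i ∈ Finset.range N, ∑ j ∈ Finset.range N, (Q j i : ℝ) * (v j * v i) =
      ∑ i ∈ Finset.range N, ∑ j ∈ Finset.range N, ((Q i j + Q j i : ℤ) : ℝ) * (v i * v j) := by
    unfold quadv
    rw [← Finset.sum_add_distrib]
    refine Finset.sum_congr rfl fun i _ => ?_
    rw [← Finset.sum_add_distrib]
    refine Finset.sum_congr rfl fun j _ => ?_
    push_cast; ring
  have hnn : 0 ≤ ∑ i ∈ Finset.range N, ∑ j ∈ Finset.range N, ((Q i j + Q j i : ℤ) : ℝ) * (v i * v j) :=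
    Finset.sum_nonneg fun i hi => Finset.sum_nonneg fun j hj =>
      mul_nonneg (by exact_mod_cast hS i (Finset.mem_range.1 hi) j (Finset.mem_range.1 hj)) (mul_nonneg (hv i) (hv j))
  linarith

end

end QCert
end HubOnly

end Summit.CriticalPhenomena.PercolationContinuityZ3.Theorems
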